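import Summits.CriticalPhenomena.PercolationContinuityZ3.Theorems.PercLowPointHalfSpaceQuantitativeBGNWallTwoGhostAKN
import HarnessLib

/-!
# `QuantitativeBGN` (stmt-CriticalPhenomena-0913), line `longrange-wall-ghost-bootstrap` — K1, mass transport on the wall

Part of the stub `stub_wallTwoGhost` (K1, basic two-ghost inequality on the wall; template
`Literature/Probability/Percolation/TwoGhostInequalityProofs.lean`, Step 2 = Hutchcroft 2020, proof of
Lemma 3.1, (3.5)–(3.6)). The augmented model is only invariant under the WALL translations `ℤ² ↷ ∂H`, so
the mass-transport principle is run among wall vertices, with the vertex density `w(F(K))/F(K)` of a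
finite `H`-cluster `K` spread over its footprint. Namespace `…Theorems.WallTwoGhost`:

* `wall_mtp`: `Σ_v f(0,v) = Σ_u f(u,0)` for transports between wall vertices diagonally invariant under
  wall translations (reindexing `u ↦ -u`);
* the density `VwH`, the state events `stEv` of the bonds `{u, u+x}`, the transport `gtr` and its
  diagonal invariance (`gtr_shift`, wall-shift covariance of `H`-clusters and invariance of `augWall`);
* out-mass `Σ_v g((0,x), v) = 1(state) NN` (`tsum_gtr_zero`, `Σ_{v ∈ K} VwH(v) = W^f(K)`), in-mass
  `Σ_u g((u,x), 0) = VwH(0) · #{bonds of type x in the state touching C_H(0)}` (`tsum_gtr_self`), and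
  **Step 2** `E[1(state of {0,x}) NN] = E[VwH(0) #bonds]` (`lintegral_stEv_NN_eq`, registered as
  `wallTwoGhost_mtp`); plus `N^op = 1(open) NN`, `N^cl = 1(closed) NN` and the finiteness of the
  `N^op`-mass (`VwH(0) #open ≤ 1`).
-/

noncomputable section

namespace Summit.CriticalPhenomena.PercolationContinuityZ3.Theorems

open MeasureTheory Filter Literature.Probability.Percolation Literature.Probability.LatticeModels
open Summit.CriticalPhenomena.PercolationContinuityZ3.Theorems.WallGhost
open scoped ENNReal

namespace WallTwoGhost
/-! ### Step 2: mass transport on the wall (Hutchcroft 2020, proof of Lemma 3.1, (3.5)–(3.6)) -/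

section MTP

open TwoGhost

/-- **The mass-transport principle for the wall translations `ℤ² ↷ ∂H`**: a transport between wall
vertices that is diagonally invariant under wall translations sends out of `0` as much as `0` receives
(on `ℤ²` this is the reindexing `u ↦ -u` of an absolutely convergent sum).
[cite: Hutchcroft2020Locality, §2, (2.1)–(2.2)] -/
theorem wall_mtp (f : Site 3 → Site 3 → ℝ≥0∞) (h0 : ∀ u v, v 0 ≠ 0 → f u v = 0) (h1 : ∀ u v, u 0 ≠ 0 → f u v = 0)
    (hinv : ∀ t : Site 3, t 0 = 0 → ∀ u v, f (u + t) (v + t) = f u v) : ∑' v, f 0 v = ∑' u, f u 0 := by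
  have key : ∀ v, f 0 v = f (-v) 0 := by
    intro v
    by_cases hv : v 0 = 0
    · have := hinv (-v) (by simp [hv]) 0 v
      rw [zero_add, add_neg_cancel] at this
      exact this.symm
    · rw [h0 0 v hv, h1 (-v) 0 (by simpa using hv)]
  simp_rw [key]
  exact (Equiv.neg (Site 3)).tsum_eq (fun u => f u 0)

open Classical in
/-- The mass density of a wall vertex of a finite `H`-cluster: `w(F(C_H(v)))/F(C_H(v))` (`0` otherwise).
[cite: Hutchcroft2020Locality, §3, proof of Lemma 3.1] -/
def VwH (n : ℕ) (ω : BondConfig (Site 3)) (v : Site 3) : ℝ≥0∞ :=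
  if v 0 = 0 ∧ (clusterH ω v).Finite then ENNReal.ofReal (wt n (footN ω v)) / (footN ω v : ℝ≥0∞) else 0

/-- The density at a wall vertex of a finite cluster. [folklore] -/
theorem VwH_of_pos {n : ℕ} {ω : BondConfig (Site 3)} {v : Site 3} (hv : v 0 = 0) (h : (clusterH ω v).Finite) :
    VwH n ω v = ENNReal.ofReal (wt n (footN ω v)) / (footN ω v : ℝ≥0∞) := by simp [VwH, hv, h]

/-- The density vanishes off the wall and on infinite clusters. [folklore] -/
theorem VwH_of_neg {n : ℕ} {ω : BondConfig (Site 3)} {v : Site 3} (h : ¬ (v 0 = 0 ∧ (clusterH ω v).Finite)) :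
    VwH n ω v = 0 := by simp only [VwH, if_neg h]

/-- The density is measurable. [folklore] -/
theorem measurable_VwH (n : ℕ) (v : Site 3) : Measurable fun ω : BondConfig (Site 3) => VwH n ω v := by
  classical
  unfold VwH
  refine measurable_ite_nat ?_ (measurable_footN v) (fun k => ENNReal.ofReal (wt n k) / (k : ℝ≥0∞)) 0
  exact (MeasurableSet.const _).inter (measurableSet_finite_clusterH v)

/-- The density is wall-translation invariant. [folklore] -/
theorem VwH_shift (n : ℕ) {t : Site 3} (ht : t 0 = 0) (ω : BondConfig (Site 3)) (v : Site 3) :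
    VwH n (shiftConfig t ω) (v + t) = VwH n ω v := by
  by_cases hv : v 0 = 0
  · have hv' : (v + t) 0 = 0 := by simp [hv, ht]
    have hvH : 0 ≤ v 0 := le_of_eq hv.symm
    by_cases hf : (clusterH ω v).Finite
    · rw [VwH_of_pos hv hf, VwH_of_pos hv' ((finite_clusterH_shiftConfig_iff ht hvH ω).2 hf), footN_shiftConfig ht hvH]
    · rw [VwH_of_neg (fun h => hf h.2), VwH_of_neg (fun h => hf ((finite_clusterH_shiftConfig_iff ht hvH ω).1 h.2))]
  · have hv' : ¬ (v + t) 0 = 0 := by simp [ht, hv]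
    rw [VwH_of_neg (fun h => hv h.1), VwH_of_neg (fun h => hv' h.1)]

/-- **Summing the densities over a cluster gives its weight**: for a wall vertex `a`,
`Σ_v 1(v ∈ C_H(a)) VwH(v) = W^f_a`. [cite: Hutchcroft2020Locality, §3, proof of Lemma 3.1] -/
theorem tsum_ind_mem_mul_VwH (n : ℕ) (ω : BondConfig (Site 3)) {a : Site 3} (ha : a 0 = 0) :
    ∑' v, ind {ω | v ∈ clusterH ω a} ω * VwH n ω v = WfH n ω a := by
  by_cases hf : (clusterH ω a).Finite
  · have hF := hf.subset (Set.inter_subset_left (t := {v : Site 3 | v 0 = 0}))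
    have hconst : ∀ v ∈ hF.toFinset, ind {ω | v ∈ clusterH ω a} ω * VwH n ω v =
        ENNReal.ofReal (wt n (footN ω a)) / (footN ω a : ℝ≥0∞) := by
      intro v hv
      rw [Set.Finite.mem_toFinset] at hv
      have hK : clusterH ω v = clusterH ω a := clusterH_eq_of_mem hv.1
      rw [ind_of_mem (show ω ∈ {ω | v ∈ clusterH ω a} from hv.1), one_mul, VwH_of_pos hv.2 (hK ▸ hf), footN, hK, footN]
    rw [tsum_eq_sum (s := hF.toFinset) (L := SummationFilter.unconditional _), Finset.sum_congr rfl hconst,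
      Finset.sum_const, nsmul_eq_mul, WfH_of_finite hf]
    · have hk : (hF.toFinset.card : ℝ≥0∞) = (footN ω a : ℝ≥0∞) := by
        rw [footN, Set.ncard_eq_toFinset_card _ hF]
      rw [hk]
      refine ENNReal.mul_div_cancel ?_ (ENNReal.natCast_ne_top _)
      exact_mod_cast Nat.one_le_iff_ne_zero.1 (one_le_footN ha hf)
    · intro v hv
      rw [Set.Finite.mem_toFinset] at hv
      by_cases hva : v ∈ clusterH ω a
      · have hv0 : ¬ v 0 = 0 := fun h => hv ⟨hva, h⟩
        rw [VwH_of_neg (fun h => hv0 h.1), mul_zero]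
      · rw [ind_of_notMem (show ω ∉ {ω | v ∈ clusterH ω a} from hva), zero_mul]
  · rw [WfH_of_infinite hf]
    refine ENNReal.tsum_eq_zero.2 fun v => ?_
    by_cases hv : v ∈ clusterH ω a
    · have hK : clusterH ω v = clusterH ω a := clusterH_eq_of_mem hv
      rw [VwH_of_neg (fun h => hf (hK ▸ h.2)), mul_zero]
    · rw [ind_of_notMem (show ω ∉ {ω | v ∈ clusterH ω a} from hv), zero_mul]

/-- The state event of the bond `{u, u + x}`: open (`b = true`) or closed. [folklore] -/
def stEv (b : Bool) (x u : Site 3) : Set (BondConfig (Site 3)) :=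
  if b then {ω | s(u, u + x) ∈ ω} else {ω | s(u, u + x) ∉ ω}

/-- Membership in the state event. [folklore] -/
theorem mem_stEv_iff (b : Bool) (x u : Site 3) (ω : BondConfig (Site 3)) :
    ω ∈ stEv b x u ↔ (s(u, u + x) ∈ ω ↔ b = true) := by
  cases b <;> simp [stEv]

/-- State events are measurable. [folklore] -/
theorem measurableSet_stEv (b : Bool) (x u : Site 3) : MeasurableSet (stEv b x u) := by
  cases b
  · exact measurableSet_notMem _
  · exact measurableSet_mem _

/-- State events are wall-translation covariant. [folklore] -/
theorem shiftConfig_mem_stEv_iff (b : Bool) (x t u : Site 3) (ω : BondConfig (Site 3)) :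
    shiftConfig t ω ∈ stEv b x (u + t) ↔ ω ∈ stEv b x u := by
  have h : s(u + t, u + t + x) ∈ shiftConfig t ω ↔ s(u, u + x) ∈ ω := by
    rw [← map_add_mem_shiftConfig_iff t ω s(u, u + x), Sym2.map_mk, add_right_comm]
  cases b
  · simp only [stEv, Bool.false_eq_true, if_false, Set.mem_setOf_eq]; exact not_congr h
  · simp only [stEv, if_true, Set.mem_setOf_eq]; exact h

open Classical in
/-- The transport: the bond `(u, x)` (a wall vertex `u`, in state `b`) sends mass `VwH(v)` to every wall
vertex `v` of the `H`-clusters of its endpoints. [cite: Hutchcroft2020Locality, §3, proof of Lemma 3.1] -/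
def gtr (b : Bool) (n : ℕ) (x u v : Site 3) (ω : BondConfig (Site 3)) : ℝ≥0∞ :=
  (if u 0 = 0 then 1 else 0) * ind (stEv b x u) ω * (ind {ω | v ∈ clusterH ω u ∨ v ∈ clusterH ω (u + x)} ω * VwH n ω v)

/-- The transport is measurable in the configuration. [folklore] -/
theorem measurable_gtr (b : Bool) (n : ℕ) (x u v : Site 3) : Measurable (gtr b n x u v) := by
  unfold gtr
  exact (measurable_const.mul (measurable_ind (measurableSet_stEv b x u))).mul
    ((measurable_ind ((measurableSet_mem_clusterH u v).union (measurableSet_mem_clusterH _ v))).mul (measurable_VwH n v))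

/-- **Diagonal invariance of the transport** under wall translations (wall type `x`).
[cite: Hutchcroft2020Locality, §3, proof of Lemma 3.1] -/
theorem gtr_shift (b : Bool) (n : ℕ) {x : Site 3} (hx : x 0 = 0) {t : Site 3} (ht : t 0 = 0) (u v : Site 3)
    (ω : BondConfig (Site 3)) : gtr b n x (u + t) (v + t) (shiftConfig t ω) = gtr b n x u v ω := by
  unfold gtr
  by_cases hu : u 0 = 0
  · have hu' : (u + t) 0 = 0 := by simp [hu, ht]
    rw [if_pos hu, if_pos hu']
    have h1 : ind (stEv b x (u + t)) (shiftConfig t ω) = ind (stEv b x u) ω := by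
      by_cases h : ω ∈ stEv b x u
      · rw [ind_of_mem h, ind_of_mem ((shiftConfig_mem_stEv_iff b x t u ω).2 h)]
      · rw [ind_of_notMem h, ind_of_notMem (fun h' => h ((shiftConfig_mem_stEv_iff b x t u ω).1 h'))]
    have huH : 0 ≤ u 0 := le_of_eq hu.symm
    have huxH : 0 ≤ (u + x) 0 := by simp [hu, hx]
    have hiff : shiftConfig t ω ∈ {ω' | v + t ∈ clusterH ω' (u + t) ∨ v + t ∈ clusterH ω' (u + t + x)} ↔
        ω ∈ {ω | v ∈ clusterH ω u ∨ v ∈ clusterH ω (u + x)} := by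
      simp only [Set.mem_setOf_eq, add_right_comm u t x]
      rw [add_mem_clusterH_shiftConfig_iff ht huH, add_mem_clusterH_shiftConfig_iff ht huxH]
    have h2 : ind {ω' | v + t ∈ clusterH ω' (u + t) ∨ v + t ∈ clusterH ω' (u + t + x)} (shiftConfig t ω) =
        ind {ω | v ∈ clusterH ω u ∨ v ∈ clusterH ω (u + x)} ω := by
      by_cases h : ω ∈ {ω | v ∈ clusterH ω u ∨ v ∈ clusterH ω (u + x)}
      · rw [ind_of_mem h, ind_of_mem (hiff.2 h)]
      · rw [ind_of_notMem h, ind_of_notMem (fun h' => h (hiff.1 h'))]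
    rw [h1, h2, VwH_shift n ht]
  · have hu' : ¬ (u + t) 0 = 0 := by simp [ht, hu]
    rw [if_neg hu, if_neg hu']
    simp

/-- The weighted count of finite clusters at the bond `e = {0, x}`:
`W^f_0 + 1(0 ∉ C_H(x)) W^f_x`. [cite: Hutchcroft2020Locality, §3, proof of Lemma 3.1] -/
def NN (n : ℕ) (x : Site 3) (ω : BondConfig (Site 3)) : ℝ≥0∞ :=
  WfH n ω 0 + ind {ω | (0 : Site 3) ∉ clusterH ω x} ω * WfH n ω x

/-- **Out-mass of the bond `(0, x)`**: `Σ_v g_b((0,x), v) = 1(state = b) NN`.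
[cite: Hutchcroft2020Locality, §3, proof of Lemma 3.1] -/
theorem tsum_gtr_zero (b : Bool) (n : ℕ) {x : Site 3} (hx : x 0 = 0) (ω : BondConfig (Site 3)) :
    ∑' v, gtr b n x 0 v ω = ind (stEv b x 0) ω * NN n x ω := by
  simp only [gtr, Pi.zero_apply, if_true, one_mul, zero_add]
  rw [ENNReal.tsum_mul_left]
  congr 1
  have hsplit : ∀ v, ind {ω | v ∈ clusterH ω 0 ∨ v ∈ clusterH ω x} ω * VwH n ω v =
      ind {ω | v ∈ clusterH ω 0} ω * VwH n ω v +
        ind {ω | (0 : Site 3) ∉ clusterH ω x} ω * (ind {ω | v ∈ clusterH ω x} ω * VwH n ω v) := by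
    intro v
    by_cases hv0 : v ∈ clusterH ω 0
    · rw [ind_of_mem (show ω ∈ {ω | v ∈ clusterH ω 0 ∨ v ∈ clusterH ω x} from Or.inl hv0),
        ind_of_mem (show ω ∈ {ω | v ∈ clusterH ω 0} from hv0), one_mul]
      by_cases h0x : (0 : Site 3) ∈ clusterH ω x
      · rw [ind_of_notMem (show ω ∉ {ω | (0 : Site 3) ∉ clusterH ω x} from fun h => h h0x), zero_mul, add_zero]
      · have hvx : v ∉ clusterH ω x := fun hvx =>
          h0x (by rw [← clusterH_eq_of_mem hvx, clusterH_eq_of_mem hv0]; exact self_mem_clusterH le_rfl ω)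
        rw [ind_of_notMem (show ω ∉ {ω | v ∈ clusterH ω x} from hvx), zero_mul, mul_zero, add_zero]
    · rw [ind_of_notMem (show ω ∉ {ω | v ∈ clusterH ω 0} from hv0), zero_mul, zero_add]
      by_cases hvx : v ∈ clusterH ω x
      · have h0x : (0 : Site 3) ∉ clusterH ω x := fun h0x => hv0 (by rw [clusterH_eq_of_mem h0x]; exact hvx)
        rw [ind_of_mem (show ω ∈ {ω | v ∈ clusterH ω 0 ∨ v ∈ clusterH ω x} from Or.inr hvx),
          ind_of_mem (show ω ∈ {ω | (0 : Site 3) ∉ clusterH ω x} from h0x),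
          ind_of_mem (show ω ∈ {ω | v ∈ clusterH ω x} from hvx), one_mul, one_mul]
      · rw [ind_of_notMem (show ω ∉ {ω | v ∈ clusterH ω 0 ∨ v ∈ clusterH ω x} from fun h => h.elim hv0 hvx),
          ind_of_notMem (show ω ∉ {ω | v ∈ clusterH ω x} from hvx)]
        simp
  simp_rw [hsplit]
  rw [ENNReal.tsum_add, ENNReal.tsum_mul_left, tsum_ind_mem_mul_VwH n ω rfl, tsum_ind_mem_mul_VwH n ω hx, NN]

/-- Sum of an indicator over a finite set of sites: its cardinality. [folklore] -/
theorem tsum_ite_mem_eq_ncard {A : Set (Site 3)} [DecidablePred (· ∈ A)] (hA : A.Finite) :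
    ∑' u : Site 3, (if u ∈ A then (1 : ℝ≥0∞) else 0) = (A.ncard : ℝ≥0∞) := by
  classical
  rw [tsum_eq_sum (s := hA.toFinset) (L := SummationFilter.unconditional _)]
  · rw [Finset.sum_congr rfl (g := fun _ => (1 : ℝ≥0∞)) fun u hu => if_pos ((Set.Finite.mem_toFinset hA).1 hu),
      Finset.sum_const, nsmul_eq_mul, mul_one, Set.ncard_eq_toFinset_card _ hA]
  · intro u hu
    rw [if_neg (fun h => hu ((Set.Finite.mem_toFinset hA).2 h))]

/-- **In-mass of the vertex `0`** from the bonds of type `x`: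
`Σ_u g_b((u,x), 0) = VwH(0) · #{bonds of type x in state b touching C_H(0)}`.
[cite: Hutchcroft2020Locality, §3, proof of Lemma 3.1] -/
theorem tsum_gtr_self (b : Bool) (n : ℕ) (x : Site 3) (ω : BondConfig (Site 3)) :
    ∑' u, gtr b n x u 0 ω = VwH n ω 0 * (nSt b ω x : ℝ≥0∞) := by
  classical
  have hterm : ∀ u, gtr b n x u 0 ω =
      (if u ∈ {u ∈ labTouch ω x | (s(u, u + x) ∈ ω ↔ b = true)} then 1 else 0) * VwH n ω 0 := by
    intro u
    rw [gtr, ← mul_assoc]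
    congr 1
    have hiff : u ∈ {u ∈ labTouch ω x | (s(u, u + x) ∈ ω ↔ b = true)} ↔
        u 0 = 0 ∧ ω ∈ stEv b x u ∧ ω ∈ {ω | (0 : Site 3) ∈ clusterH ω u ∨ (0 : Site 3) ∈ clusterH ω (u + x)} := by
      rw [Set.mem_setOf_eq, mem_labTouch, mem_stEv_iff, Set.mem_setOf_eq, mem_clusterH_comm (x := u),
        mem_clusterH_comm (x := u + x)]
      tauto
    by_cases hA : u ∈ {u ∈ labTouch ω x | (s(u, u + x) ∈ ω ↔ b = true)}
    · obtain ⟨h1, h2, h3⟩ := hiff.1 hA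
      rw [if_pos hA, if_pos h1, ind_of_mem h2, ind_of_mem h3, one_mul, one_mul]
    · rw [if_neg hA]
      by_cases h1 : u 0 = 0
      · rw [if_pos h1, one_mul]
        by_cases h2 : ω ∈ stEv b x u
        · have h3 : ω ∉ {ω | (0 : Site 3) ∈ clusterH ω u ∨ (0 : Site 3) ∈ clusterH ω (u + x)} :=
            fun h3 => hA (hiff.2 ⟨h1, h2, h3⟩)
          rw [ind_of_notMem h3, mul_zero]
        · rw [ind_of_notMem h2, zero_mul]
      · rw [if_neg h1, zero_mul, zero_mul]
  simp_rw [hterm]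
  rw [ENNReal.tsum_mul_right, mul_comm]
  by_cases hf : (clusterH ω 0).Finite
  · have hfin : ({u | u ∈ labTouch ω x ∧ (s(u, u + x) ∈ ω ↔ b = true)} : Set (Site 3)).Finite :=
      (labTouch_finite hf x).subset fun u hu => hu.1
    rw [tsum_ite_mem_eq_ncard hfin, nSt]
  · rw [VwH_of_neg (fun h => hf h.2), zero_mul, zero_mul]

/-- **Step 2** (mass transport for the bonds of type `x` at the wall): for a wall type `x`,
`E[1(state of {0,x} = b) NN] = E[VwH(0) · #{bonds of type x in state b touching C_H(0)}]`.
[cite: Hutchcroft2020Locality, §3, proof of Lemma 3.1] -/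
theorem lintegral_stEv_NN_eq (p : unitInterval) (lam α : ℝ) (b : Bool) (n : ℕ) {x : Site 3} (hx : x 0 = 0) :
    ∫⁻ ω, ind (stEv b x 0) ω * NN n x ω ∂(augWall p lam α) =
      ∫⁻ ω, VwH n ω 0 * (nSt b ω x : ℝ≥0∞) ∂(augWall p lam α) := by
  set P := augWall p lam α with hP
  set Γ : Site 3 → Site 3 → ℝ≥0∞ := fun u v => ∫⁻ ω, gtr b n x u v ω ∂P with hΓ
  have h0 : ∀ u v, v 0 ≠ 0 → Γ u v = 0 := by
    intro u v hv
    simp only [hΓ]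
    refine (lintegral_eq_zero_iff (measurable_gtr b n x u v)).2 (Filter.Eventually.of_forall fun ω => ?_)
    simp only [gtr, VwH_of_neg (fun h => hv h.1), mul_zero, Pi.zero_apply]
  have h1 : ∀ u v, u 0 ≠ 0 → Γ u v = 0 := by
    intro u v hu
    simp only [hΓ]
    refine (lintegral_eq_zero_iff (measurable_gtr b n x u v)).2 (Filter.Eventually.of_forall fun ω => ?_)
    simp only [gtr, if_neg hu, zero_mul, Pi.zero_apply]
  have hinv : ∀ t : Site 3, t 0 = 0 → ∀ u v, Γ (u + t) (v + t) = Γ u v := by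
    intro t ht u v
    simp only [hΓ]
    rw [← lintegral_shiftConfig p lam α ht (gtr b n x (u + t) (v + t))]
    exact lintegral_congr fun ω => gtr_shift b n hx ht u v ω
  have hmtp := wall_mtp Γ h0 h1 hinv
  have hout : ∑' v, Γ 0 v = ∫⁻ ω, ind (stEv b x 0) ω * NN n x ω ∂P := by
    simp only [hΓ]
    rw [← lintegral_tsum fun v => (measurable_gtr b n x 0 v).aemeasurable]
    exact lintegral_congr fun ω => tsum_gtr_zero b n hx ω
  have hin : ∑' u, Γ u 0 = ∫⁻ ω, VwH n ω 0 * (nSt b ω x : ℝ≥0∞) ∂P := by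
    simp only [hΓ]
    rw [← lintegral_tsum fun u => (measurable_gtr b n x u 0).aemeasurable]
    exact lintegral_congr fun ω => tsum_gtr_self b n x ω
  rw [← hout, hmtp, hin]

end MTP


/-! ### Step 3: from the transport identity to `|Z^c|` (end of the proof of Lemma 3.1) -/

section Combine

open TwoGhost

/-- The state events of the bond `{0, x}`. [folklore] -/
theorem stEv_zero (b : Bool) (x : Site 3) :
    stEv b x 0 = if b then {ω | s((0 : Site 3), x) ∈ ω} else {ω | s((0 : Site 3), x) ∉ ω} := by
  simp only [stEv, zero_add]

/-- `N^op_e = 1(e open) NN_e` (when `e` is open there is one cluster at `e`). [folklore] -/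
theorem Nop_eq (n : ℕ) {x : Site 3} (hx : 0 ≤ x 0) (hx0 : x ≠ 0) (ω : BondConfig (Site 3)) :
    Nop n x ω = ind (stEv true x 0) ω * NN n x ω := by
  rw [stEv_zero, if_pos rfl, Nop, NN]
  by_cases he : s((0 : Site 3), x) ∈ ω
  · have hK : clusterH ω x = clusterH ω 0 := clusterH_eq_of_mk_mem le_rfl hx hx0.symm he
    rw [ind_of_notMem (show ω ∉ {ω | (0 : Site 3) ∉ clusterH ω x} from fun h => h (hK ▸ self_mem_clusterH le_rfl ω)),
      zero_mul, add_zero]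
  · rw [ind_of_notMem (show ω ∉ {ω | s((0 : Site 3), x) ∈ ω} from he), zero_mul, zero_mul]

/-- `N^cl_e = 1(e closed) NN_e`. [folklore] -/
theorem Ncl_eq (n : ℕ) (x : Site 3) (ω : BondConfig (Site 3)) : Ncl n x ω = ind (stEv false x 0) ω * NN n x ω := by
  rw [stEv_zero, Ncl, NN]
  rfl

/-- The `N^op`-mass is at most `1`: an open wall bond touching `C_H(0)` has its tail in `C_H(0)`, so
`VwH(0) · #open ≤ (w(F)/F) · F ≤ 1`. [folklore] -/
theorem VwH_mul_nSt_true_le_one (n : ℕ) {x : Site 3} (hx0 : x 0 = 0) (hx : x ≠ 0) (ω : BondConfig (Site 3)) :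
    VwH n ω 0 * (nSt true ω x : ℝ≥0∞) ≤ 1 := by
  by_cases hf : (clusterH ω 0).Finite
  · rw [VwH_of_pos rfl hf]
    have hF : 1 ≤ footN ω 0 := one_le_footN rfl hf
    have hle : nSt true ω x ≤ footN ω 0 := nSt_true_le_footN hf hx0 hx
    have hF0 : (footN ω 0 : ℝ≥0∞) ≠ 0 := by exact_mod_cast (show footN ω 0 ≠ 0 by omega)
    calc ENNReal.ofReal (wt n (footN ω 0)) / (footN ω 0 : ℝ≥0∞) * (nSt true ω x : ℝ≥0∞)
        ≤ 1 / (footN ω 0 : ℝ≥0∞) * (footN ω 0 : ℝ≥0∞) :=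
          mul_le_mul' (ENNReal.div_le_div_right (ENNReal.ofReal_le_one.2 (wt_le_one _ _)) _) (by exact_mod_cast hle)
      _ = 1 := ENNReal.div_mul_cancel hF0 (ENNReal.natCast_ne_top _)
  · rw [VwH_of_neg (fun h => hf h.2), zero_mul]; exact zero_le_one

end Combine

end WallTwoGhost

open WallTwoGhost TwoGhost in
/-- **K1, part 8 (mass transport on the wall).** For a wall type `x` and a state `b`, the expected
weighted number of finite `H`-clusters at the bond `{0,x}` in state `b` equals the expected vertex density
`w(F)/F` of `C_H(0)` times the number of bonds of type `x` in state `b` touching `C_H(0)` — the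
mass-transport principle for the wall translations `ℤ²`. [cite: Hutchcroft2020Locality, §3, proof of Lemma 3.1] -/
theorem wallTwoGhost_mtp : ∀ (p : unitInterval) (lam α : ℝ) (b : Bool) (n : ℕ) (x : Site 3), x 0 = 0 → ∫⁻ ω, ind (stEv b x 0) ω * NN n x ω ∂(augWall p lam α) = ∫⁻ ω, VwH n ω 0 * (nSt b ω x : ℝ≥0∞) ∂(augWall p lam α) :=
  fun p lam α b n _ hx => lintegral_stEv_NN_eq p lam α b n hx

end Summit.CriticalPhenomena.PercolationContinuityZ3.Theorems
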